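import Summits.BirchSwinnertonDyer.Rank1Residual.Additive.X3BranchDegenerateCount
import Literature.NumberTheory.EllipticCurves.GreenbergVatsal2000.ResidualLiftingEven
import HarnessLib

/-!
# X3, the DEGENERATE rows: the count of `X3BranchDegenerateCount.lean` on the two cells (G-ord, `e = 2`)
# and (M) of the semistable-twist locus, in the `λ(g)` currency of the certificate road — the twisted
# Greenberg / Tate data of bsd-addord, the ramified `χ_K`-twist of the TRIVIAL line, and `hLamW` from
# the count + the displayed evaluation (cell `bsd-eis`, seat `bsd-eis-x3` gen 2; sequel of
# `X3BranchDegenerateCount.lean`; route K1 `AdditiveBranchIMC`, crux `GordTwoRankZeroOffCaseOne` /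
# `MultLower` — supports only)

HONEST FRAMING (cell `bsd-eis`, `run/shared/lean/pub/bsd-eis/README.md` §4): the programme's target of
record is the full Birch–Swinnerton-Dyer formula for every `E/ℚ` of analytic rank `≤ 1`; this file
concerns the DEGENERATE X3 rows of the semistable-twist locus (rational `p`-line with TRIVIAL
character on the ramified ordinary line of the twisted datum; at `p = 3`: `W[3]^{ss} = {1, ω}`).
THEOREMS ONLY (no `def`, no named fact, no `sorry`); nothing is booked; no label, tier or count of
record moves. PUBLISHED records used: `h23`, `hRQ` (GV Remark (2.7) ¶2), `hGrK` (Greenberg Props.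
2.2/2.4) / `hT40`, `hT41` (Tate uniformisation), `hLiftE` (GV p. 28/30 lifting for an EVEN line — the
trivial line is even: reading flag for the referee, the printed proof uses only evenness). DISPLAYED:
`hA` (`W(ℚ_∞)[p^∞]` finite — Imai/Ribet, not in the tree) and, in §2, the evaluation `hn`.

* §1 `not_forall_chi_of_trivialLine` — the `χ_K`-twist of the trivial line is RAMIFIED at `p` (an
  inertia element negating `√p*` lies off `Gal(ℚ̄/K)` and fixes the line): the binder `hram` of
  bsd-addord's twisted data; **`X3Branch.algebraicCountW_degenerate_of_facts`** ((G-ord, `e = 2`)) and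
  **`X3Branch.algebraicCountWMult_degenerate_of_facts`** ((M)): for every cyclotomic `κ` with
  `W(ℚ_∞)[p^∞]` finite, generator `γ`, TORSION dual datum `D` of `Sel_{p^∞}(W/ℚ_∞)` and unit-content
  generator `g` of `char D.X`: `p^{λ(g) + Σ_{v∈Σ₀} δ_v(W) + 1} = #H¹(ℚ_Σ/ℚ_∞, Φ₀)·#U(W[p]/Φ₀)`.
* §2 `X3Branch.lamEqW_of_countSucc_of_eval` — count + the displayed evaluation
  `p^{n + Σδ + 1} = #H¹·#U` ⟹ `λ(g) = n`: the `hLamW` input of the certificate road's end states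
  (`ClassX3Gord.missingLowerBoundAt_rankZero_of_unitCoeffCert_of_lamEqW`, `ClassX3M.…`); x3-MEMO-3
  (ALG-deg′) reads `n = Σ_ℓ s_ℓ t_ℓ(E) − 2`.

## What this is NOT

Not the evaluation of the residual count (class-field theory over `ℚ_∞` for the trivial and
Teichmüller characters; displayed `hn`); not `hA`; not a class theorem; not the analytic side (per
pair: the unit-coefficient certificate of `X3BranchCertificateRoad.lean`); not rank `1`.

References: [GreenbergVatsal2000] §2 pp. 14–15, 26–30, Cor. (2.3), Remark (2.7), Prop. (2.8), Remark
(2.9); [GreenbergLNM1716] Props. 2.2, 2.4; [SilvermanATAEC1994] V.5.3/5.4; [Lang1983] Ch. 6 Prop. 1.3;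
cell files `run/shared/lean/pub/bsd-eis/x3-MEMO-2.md` D1–D4, `x3-MEMO-3.md` §1–§2.
-/

set_option autoImplicit false

noncomputable section

open scoped Classical AddSubgroup

namespace Summit.BirchSwinnertonDyer.Rank1Residual.Additive

open NumberField IsDedekindDomain Field WeierstrassCurve
  Literature.NumberTheory.GaloisRepresentations
  Literature.NumberTheory.EllipticCurves
  Literature.NumberTheory.EllipticCurves.GreenbergSelmer
  Literature.NumberTheory.EllipticCurves.GreenbergVatsal2000
  Literature.NumberTheory.EllipticCurves.EmertonPollackWeston2006
  Literature.NumberTheory.EllipticCurves.Rank1Residual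
  Summit.BirchSwinnertonDyer.Rank1Residual.X2
  Summit.BirchSwinnertonDyer.Rank1Residual.X2.GreenbergVatsalTorsion
  Summit.BirchSwinnertonDyer.Rank1Residual.X2.GreenbergVatsalReductionDatum
  Summit.BirchSwinnertonDyer.Rank1Residual.X2.ResidualDevissageLine
  Summit.BirchSwinnertonDyer.Rank1Residual.X2.NonPrimitiveSelmerDual
  Summit.BirchSwinnertonDyer.Rank1Residual.X1.MuLambda
  Summit.BirchSwinnertonDyer.Rank1Residual.GaloisImage.RamifiedOrdinaryLineTwist
  Summit.BirchSwinnertonDyer.Rank1Residual.AdditivePotMult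
  Summit.BirchSwinnertonDyer.Rank1Residual.AdditivePotMult.RamifiedOrdinaryLinePotMult
  Summit.BirchSwinnertonDyer.Rank1Residual.Additive.TameDescent

/-! ### §1 The two cells: (G-ord, `e = 2`) and (M), in the `λ(g)` currency of the certificate road -/

section Cells

variable {p : ℕ} [hp : Fact p.Prime] {W : WeierstrassCurve ℚ} [W.IsElliptic] [W.IsGloballyMinimal]

omit [W.IsElliptic] [W.IsGloballyMinimal] in
/-- **The `χ_K`-twist of the TRIVIAL line is ramified at `p`** (`p` odd, `K = ℚ(θ)`, `θ² = p*`): an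
inertia element at `p` negating `√p*` (`exists_mem_absInertia_smul_geomSqrt_pStar_eq_neg`, Kummer
theory) lies off `Gal(ℚ̄/K)` and FIXES the line, so it does not act through `χ_K` on a non-zero point
(`P = −P` with `pP = 0` forces `P = 0`). This is the binder `hram` of bsd-addord's twisted data for the
degenerate line. [cite: Lang1983, Ch. 6 Prop. 1.3] [cite: GreenbergVatsal2000, §2 p. 28] -/
theorem not_forall_chi_of_trivialLine (hp2 : p ≠ 2)
    {Φ₀ : AddSubgroup (W.geomTorsion (p : ℤ))} (hΦ : IsRationalLine W p Φ₀)
    (htriv : ∀ (σ : absoluteGaloisGroup ℚ) (P : geomTorsion W (p : ℤ)), P ∈ Φ₀ → σ • P = P)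
    (K : Type) [Field K] [NumberField K]
    (hθ : ∃ θ : K, θ ^ 2 = algebraMap ℚ K ((-1) ^ (p / 2) * p)) :
    ¬ ∀ w : HeightOneSpectrum (𝓞 ℚ), ((p : ℕ) : 𝓞 ℚ) ∈ w.asIdeal →
      ∀ 𝔓 ∈ w.primesAbove, ∀ σ ∈ 𝔓.inertia (absoluteGaloisGroup ℚ), ∀ P ∈ Φ₀,
        σ • P = (if σ ∈ galRange (K := ℚ) K then P else -P) := by
  intro hall
  obtain ⟨θ, hθ⟩ := hθ
  -- a non-zero point of the line
  haveI : Finite Φ₀ := Nat.finite_of_card_ne_zero (by rw [hΦ.1]; exact hp.out.ne_zero)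
  haveI : Nontrivial Φ₀ := Finite.one_lt_card_iff_nontrivial.mp (by rw [hΦ.1]; exact hp.out.one_lt)
  obtain ⟨⟨P₀, hP₀⟩, hP₀ne⟩ := exists_ne (0 : Φ₀)
  have hP₀0 : P₀ ≠ 0 := fun h ↦ hP₀ne (Subtype.ext h)
  -- an inertia element at `p` negating `√p*`
  obtain ⟨v, hv⟩ :=
    Literature.NumberTheory.NumberFields.RingOfIntegers.exists_heightOneSpectrum_natCast_mem ℚ hp.out
  obtain ⟨σ, hσI, hσneg⟩ := exists_mem_absInertia_smul_geomSqrt_pStar_eq_neg p hp2 hv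
  set τ : absoluteGaloisGroup ℚ := absGaloisRestrict ℚ (v.adicCompletion ℚ) σ with hτ
  have hτI : τ ∈ (adicCompletionPrime ℚ v).inertia (absoluteGaloisGroup ℚ) := by
    rw [inertia_adicCompletionPrime_eq_map_absInertia]
    exact Subgroup.mem_map.2 ⟨σ, hσI, rfl⟩
  -- `τ ∉ galRange K`: it negates `j(θ) = ±√p*`
  have hsqθ := embIntoClosure_sq K hθ
  have hsqr := geomSqrt_sq ((-1 : ℚ) ^ (p / 2) * (p : ℚ))
  have hpm : embIntoClosure (K := ℚ) K θ = geomSqrt ((-1 : ℚ) ^ (p / 2) * (p : ℚ)) ∨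
      embIntoClosure (K := ℚ) K θ = -geomSqrt ((-1 : ℚ) ^ (p / 2) * (p : ℚ)) :=
    sq_eq_sq_iff_eq_or_eq_neg.mp (hsqθ.trans hsqr.symm)
  have hr0 : geomSqrt ((-1 : ℚ) ^ (p / 2) * (p : ℚ)) ≠ -geomSqrt ((-1 : ℚ) ^ (p / 2) * (p : ℚ)) :=
    geomSqrt_ne_neg (pStar_ne_zero p)
  have hτK : τ ∉ galRange (K := ℚ) K := by
    apply not_mem_galRange_of_smul_embIntoClosure_ne K
    rcases hpm with h | h
    · rw [h, hσneg]
      exact fun e ↦ hr0 e.symm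
    · rw [h, smul_neg, hσneg, neg_neg]
      exact hr0
  -- contradiction: `τ • P₀ = -P₀` by `hall`, but `τ` fixes `P₀ ≠ 0`
  have hτP := hall v hv (adicCompletionPrime ℚ v) (adicCompletionPrime_mem_primesAbove ℚ v) τ hτI
    P₀ hP₀
  rw [if_neg hτK, htriv τ P₀ hP₀] at hτP
  apply hP₀0
  refine X2.ResidualDevissageLine.eq_zero_of_two_nsmul_eq_zero (hp.out.odd_of_ne_two hp2) P₀
    (X2.ResidualDevissageLine.nsmul_eq_zero_of_mem_geomTorsion P₀) ?_
  rw [two_nsmul]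
  nth_rewrite 2 [hτP]
  exact add_neg_cancel P₀

/-- **(G-ord, `e = 2`), DEGENERATE rows: the count in the `λ(g)` currency of the certificate road.**
`p` odd; `V` globally minimal GOOD ORDINARY at `p` with `C • V^{(p*)} = W`; `Σ₀ ∌ p` finite NONEMPTY
with the bad places `≠ p` inside; `Φ₀ ≤ W[p]` a rational line with TRIVIAL `Γ_ℚ`-action (a rational
point of order `p` on the ordinary line of the twisted datum); `κ` cyclotomic with generator `γ`,
`W(ℚ_∞)[p^∞]` finite (`hA`, displayed: Imai/Ribet); `D` a TORSION dual datum of `Sel_{p^∞}(W/ℚ_∞)`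
and `g` a unit-content generator of `char D.X`. THEN
`p^{λ(g) + Σ_{v∈Σ₀} δ_v(W) + 1} = #H¹(ℚ_Σ/ℚ_∞, Φ₀)·#U(W[p]/Φ₀)` — GRANTED the records `h23`, `hRQ`,
`hGrK` (Greenberg Props. 2.2/2.4: R-D identity) and `hLiftE` (GV p. 28/30 lifting for an EVEN line —
the trivial line is even). (ALG-deg′) of x3-MEMO-3 with the count unevaluated.
[cite: GreenbergVatsal2000, §2 pp. 26–30 (display (16), (11)), Remark (2.7), Prop. (2.8), Remark (2.9)]
[cite: GreenbergLNM1716, Props. 2.2, 2.4 (pp. 73–75)] -/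
theorem X3Branch.algebraicCountW_degenerate_of_facts
    (h23 : datumSelmer_nonPrimitive_invariants)
    (hRQ : datumSelmer_divisible_of_finite_torsionBy_of_gr_inertiaInvariants_eq_zero)
    (hGrK : Greenberg1999.imKummer_ge_strictCondition_goodOrdinary)
    (hLiftE : residualEpsilon_surjOn_of_lineEven)
    (hp2 : p ≠ 2) (V : WeierstrassCurve ℚ) [V.IsElliptic] [V.IsGloballyMinimal] (hV : GoodOrd V p)
    {C : VariableChange ℚ} (hC : C • V.quadraticTwist ((-1 : ℚ) ^ (p / 2) * p) = W)
    (S₀ : Finset (HeightOneSpectrum (𝓞 ℚ))) (hne : S₀.Nonempty)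
    (hS₀ : ∀ v ∈ S₀, ((p : ℕ) : 𝓞 ℚ) ∉ v.asIdeal)
    (hS : ∀ v : HeightOneSpectrum (𝓞 ℚ), v ∉ S₀ → ((p : ℕ) : 𝓞 ℚ) ∉ v.asIdeal →
      W.HasGoodReductionAt v)
    (Φ₀ : AddSubgroup (W.geomTorsion (p : ℤ))) (hΦ : IsRationalLine W p Φ₀)
    (htriv : ∀ (σ : absoluteGaloisGroup ℚ) (P : geomTorsion W (p : ℤ)), P ∈ Φ₀ → σ • P = P)
    {κ : ZpExtension ℚ p} {γ : absoluteGaloisGroup ℚ}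
    (hA : Finite (FixedPoints.addSubgroup κ.kerSubgroup (W.geomPrimaryTorsion p)))
    (D : W.SelmerDualData κ γ) (g : IwasawaAlgebra p) (hκ : κ.IsCyclotomic) (hγ : κ.IsTopGenerator γ)
    (hDt : D.IsTorsion) (hchar : D.charIdeal = Ideal.span {g}) (hμg : HasUnitContent g) :
    p ^ (lam g + ∑ v ∈ S₀, delta W p v + 1) =
      Nat.card (residualLineH1 W p κ S₀ Φ₀ hΦ) * Nat.card (residualQuotSelmer W p κ S₀ Φ₀ hΦ) := by
  obtain ⟨K, _, _, h2, θ, hθ, hc⟩ := exists_numberField_sq_eq_pStar (p := p) hp2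
  haveI : IsGalois ℚ K := isGalois_of_finrank_eq_two K h2
  haveI : (galRange (K := ℚ) K).Normal := normal_galRange K h2 (sigmaQ_ne_one K h2 hθ hc)
  have hram := not_forall_chi_of_trivialLine (W := W) hp2 hΦ htriv K ⟨θ, hc⟩
  have heven : LineEven W p Φ₀ := fun c _ P hP ↦ htriv c P hP
  -- the twisted Greenberg data: ramified ordinary lines whose `p`-torsion plus-part is `Φ₀`
  obtain ⟨Lf, hLf, hplus⟩ :=
    exists_data_isRamifiedOrdinaryLine_plus_eq_lineSub V K h2 hθ p hc hC hp2 hV hΦ hram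
  have hRD : ∀ (v : HeightOneSpectrum (𝓞 ℚ)) (hv : ((p : ℕ) : 𝓞 ℚ) ∈ v.asIdeal),
      (Lf v hv).greenbergKer κ.kerSubgroup = W.localKerOver p κ.kerSubgroup (v.adicCompletion ℚ) :=
    fun v hv ↦ ramifiedLineKummerEqAt_of_goodOrd_pStar_twist p hGrK hp2 V ⟨C, hC⟩ hV κ hκ v hv
      (Lf v hv) (hLf v hv)
  haveI : Module.Finite (IwasawaAlgebra p) D.X := D.module_finite_holds hγ
  have hg0 : g ≠ 0 := X11a.ne_zero_of_hasUnitContent hμg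
  have hμ : D.mu = 0 := (mu_eq_zero_iff_hasUnitContent D hDt hchar).mpr hμg
  have hlam : lam g = lambdaInvariant p D.X :=
    X1.ParitySqueeze.lam_generator_eq_lambdaInvariant D.X hDt hg0 hchar
  rw [hlam]
  exact (natCard_line_mul_quotSelmer_eq_of_data_of_lifting_of_trivialLine h23 hRQ hp2 hκ hγ Lf hLf hRD
    S₀ hne hS₀ hS hΦ htriv hA hplus (hLiftE W p κ S₀ Φ₀ hΦ hp2 hκ heven hS₀ hS) D hDt hμ).symm

/-- **(M), DEGENERATE rows: the count in the `λ(g)` currency.** As the previous theorem with `V`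
MULTIPLICATIVE at `p`, `W` potentially multiplicative (`hpm`), the twisted TATE datum (records
`hT40`/`hT41`, Silverman V.5.3/5.4) and its R-D identity (`PotMult.ramifiedLineKummerEqAt`).
[cite: GreenbergVatsal2000, §2 pp. 14–15, 26–30, Remark (2.7), Prop. (2.8), Remark (2.9)]
[cite: SilvermanATAEC1994, Ch. V Thm. 5.3, Cor. 5.4] -/
theorem X3Branch.algebraicCountWMult_degenerate_of_facts
    (h23 : datumSelmer_nonPrimitive_invariants)
    (hRQ : datumSelmer_divisible_of_finite_torsionBy_of_gr_inertiaInvariants_eq_zero)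
    (hT40 : Silverman1994_thmV53_tateUniformisation.{0})
    (hT41 : Silverman1994_thmV53_corV54_tateUniformisation.{0})
    (hLiftE : residualEpsilon_surjOn_of_lineEven)
    (hp2 : p ≠ 2) (hpm : AdditivePotMult.PotMult W p) (V : WeierstrassCurve ℚ) [V.IsElliptic]
    [V.IsGloballyMinimal] (hmult : Mult V p) {C : VariableChange ℚ}
    (hC : C • V.quadraticTwist ((-1 : ℚ) ^ (p / 2) * p) = W)
    (S₀ : Finset (HeightOneSpectrum (𝓞 ℚ))) (hne : S₀.Nonempty)
    (hS₀ : ∀ v ∈ S₀, ((p : ℕ) : 𝓞 ℚ) ∉ v.asIdeal)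
    (hS : ∀ v : HeightOneSpectrum (𝓞 ℚ), v ∉ S₀ → ((p : ℕ) : 𝓞 ℚ) ∉ v.asIdeal →
      W.HasGoodReductionAt v)
    (Φ₀ : AddSubgroup (W.geomTorsion (p : ℤ))) (hΦ : IsRationalLine W p Φ₀)
    (htriv : ∀ (σ : absoluteGaloisGroup ℚ) (P : geomTorsion W (p : ℤ)), P ∈ Φ₀ → σ • P = P)
    {κ : ZpExtension ℚ p} {γ : absoluteGaloisGroup ℚ}
    (hA : Finite (FixedPoints.addSubgroup κ.kerSubgroup (W.geomPrimaryTorsion p)))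
    (D : W.SelmerDualData κ γ) (g : IwasawaAlgebra p) (hκ : κ.IsCyclotomic) (hγ : κ.IsTopGenerator γ)
    (hDt : D.IsTorsion) (hchar : D.charIdeal = Ideal.span {g}) (hμg : HasUnitContent g) :
    p ^ (lam g + ∑ v ∈ S₀, delta W p v + 1) =
      Nat.card (residualLineH1 W p κ S₀ Φ₀ hΦ) * Nat.card (residualQuotSelmer W p κ S₀ Φ₀ hΦ) := by
  obtain ⟨K, _, _, h2, θ, hθ, hc⟩ := exists_numberField_sq_eq_pStar (p := p) hp2
  haveI : IsGalois ℚ K := isGalois_of_finrank_eq_two K h2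
  haveI : (galRange (K := ℚ) K).Normal := normal_galRange K h2 (sigmaQ_ne_one K h2 hθ hc)
  have hram := not_forall_chi_of_trivialLine (W := W) hp2 hΦ htriv K ⟨θ, hc⟩
  have heven : LineEven W p Φ₀ := fun c _ P hP ↦ htriv c P hP
  obtain ⟨Lf, hLf, hplus⟩ := exists_data_isRamifiedOrdinaryLine_plus_eq_lineSub_of_mult_twist V K
    h2 hθ p hc hC hT40 hT41 hp2 hmult hΦ hram
  have hRD : ∀ (v : HeightOneSpectrum (𝓞 ℚ)) (hv : ((p : ℕ) : 𝓞 ℚ) ∈ v.asIdeal),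
      (Lf v hv).greenbergKer κ.kerSubgroup = W.localKerOver p κ.kerSubgroup (v.adicCompletion ℚ) :=
    fun v hv ↦ AdditivePotMult.PotMult.ramifiedLineKummerEqAt hT40 hT41 hp2 hpm κ hκ v hv (Lf v hv)
      (hLf v hv)
  haveI : Module.Finite (IwasawaAlgebra p) D.X := D.module_finite_holds hγ
  have hg0 : g ≠ 0 := X11a.ne_zero_of_hasUnitContent hμg
  have hμ : D.mu = 0 := (mu_eq_zero_iff_hasUnitContent D hDt hchar).mpr hμg
  have hlam : lam g = lambdaInvariant p D.X :=
    X1.ParitySqueeze.lam_generator_eq_lambdaInvariant D.X hDt hg0 hchar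
  rw [hlam]
  exact (natCard_line_mul_quotSelmer_eq_of_data_of_lifting_of_trivialLine h23 hRQ hp2 hκ hγ Lf hLf hRD
    S₀ hne hS₀ hS hΦ htriv hA hplus (hLiftE W p κ S₀ Φ₀ hΦ hp2 hκ heven hS₀ hS) D hDt hμ).symm

/-! ### §2 `hLamW` on the degenerate rows from the count + the displayed EVALUATION -/

omit [W.IsElliptic] [W.IsGloballyMinimal] in
/-- **Degenerate count + EVALUATION ⟹ `λ(g) = n`** (the `hLamW` input of the certificate road,
`X3BranchCertificateRoad[Mult|Gord].lean`): from a count `p^{λ(g) + Σδ + 1} = #H¹·#U` (`hcount`: the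
two previous theorems) and the displayed evaluation `hn : p^{n + Σδ + 1} = #H¹(ℚ_Σ/ℚ_∞, 𝔽_p)·#U(μ_p)`
for every cyclotomic `κ` (class-field theory over `ℚ_∞`: `#H¹ = p^{Σ_{ℓ∈Σ₀, ℓ≡1 (p)} s_ℓ}`,
`#U = p^{Σ_{ℓ∈Σ₀} s_ℓ − 1}`, so `n = Σ_ℓ s_ℓ t_ℓ(E) − 2`, x3-MEMO-2 D3; per pair an instrument datum;
displayed, NOT asserted), `λ(g) = n`. Injectivity of `p^·`. [cite: GreenbergVatsal2000, §2 Cor. (2.3), p. 30] -/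
theorem X3Branch.lamEqW_of_countSucc_of_eval (S₀ : Finset (HeightOneSpectrum (𝓞 ℚ)))
    {Φ₀ : AddSubgroup (W.geomTorsion (p : ℤ))} (hΦ : IsRationalLine W p Φ₀) {n : ℕ}
    (hcount : ∀ {κ : ZpExtension ℚ p} {γ : Field.absoluteGaloisGroup ℚ} (D : W.SelmerDualData κ γ)
      (g : IwasawaAlgebra p), κ.IsCyclotomic → κ.IsTopGenerator γ → D.IsTorsion →
      D.charIdeal = Ideal.span {g} → HasUnitContent g →
        p ^ (lam g + ∑ v ∈ S₀, delta W p v + 1) =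
          Nat.card (residualLineH1 W p κ S₀ Φ₀ hΦ) * Nat.card (residualQuotSelmer W p κ S₀ Φ₀ hΦ))
    (hn : ∀ (κ : ZpExtension ℚ p), κ.IsCyclotomic →
      p ^ (n + ∑ v ∈ S₀, delta W p v + 1) =
        Nat.card (residualLineH1 W p κ S₀ Φ₀ hΦ) * Nat.card (residualQuotSelmer W p κ S₀ Φ₀ hΦ))
    {κ : ZpExtension ℚ p} {γ : Field.absoluteGaloisGroup ℚ} (D : W.SelmerDualData κ γ)
    (g : IwasawaAlgebra p) (hκ : κ.IsCyclotomic) (hγ : κ.IsTopGenerator γ) (hDt : D.IsTorsion)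
    (hchar : D.charIdeal = Ideal.span {g}) (hμg : HasUnitContent g) : lam g = n := by
  have hpow : p ^ (lam g + ∑ v ∈ S₀, delta W p v + 1) = p ^ (n + ∑ v ∈ S₀, delta W p v + 1) :=
    (hcount D g hκ hγ hDt hchar hμg).trans (hn κ hκ).symm
  have := Nat.pow_right_injective hp.out.two_le hpow
  omega

end Cells

end Summit.BirchSwinnertonDyer.Rank1Residual.Additive

end
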